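import Literature.MathematicalPhysics.QuantumFieldTheory.Balaban1983to89.B9Thm311SmallFieldClosed

/-!
# `Balaban1983to89.B9Eq335SmallBondsData` — T. Bałaban, *Propagators for lattice gauge theories in a background field*, Commun. Math. Phys.
# **99** (1985) 389–434 [Balaban1985BackgroundPropagators] p. 396 (3.35)–(3.37) / Thm 3.11 p. 416: THE DISPLAYED STRUCTURAL DATA OF THE NE9
# CHAIN'S TORUS BACKGROUND (`hU1`, `hreg`, `hα`, `hα1`, `hαL` of `B9Eq315QTorus`) READ OFF ONE NUMBER — UNIT-BOUNDED BONDS `ε`-CLOSE TO `1` WITH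
# `ε ≤ ε_reg(d, L) = 1∕(256(d+1)²L^{d+1})` — and [B9] Thm 3.11 for the assembled `Δ_a(U)` re-cut with the background binders
# {`U(b) ∈ U1`, `‖U(b) − 1‖ ≤ ε`, `hRS` ∕ unitary} ONLY

statement-level skeleton of published theorems with citation tags; proofs where landed; nothing here is a claim about the Yang–Mills mass gap

PDF held: `paper:balaban1985-cmp99-background-propagators` (journal page = PDF page + 388); p. 396 [PDF 8] read on the text layer (2026-08-22,
re-read after the readers' A-1, ne9-leaf-02 g59 ∕ ne9-leaf-04 g72 — v1.1 DOCFIX of this paragraph and of MODEL below; decls byte-identical):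
print's regularity class is (3.35) *«for an arbitrary cube □ of the described above class, and for a configuration U there exists a gauge
transformation u on □ such that U^u = e^{iηA}, and if the index of □ is j, then |A| < O(1)Mα₀(L^jη)⁻¹, |∇^ηA| < O(1)Mα₀(L^jη)⁻² on □, where
O(1)M is a size of □ in T_{L^{−j}}»*, (3.36) adds *«|∂^{η*}∂^ηA| < O(1)Mα₀(L^jη)⁻³ on □»*, and (3.37) bounds the complex part `A′` of `U′U`,
`U′ = e^{iηA′}` (*«|A′| < α₁(L^jη)⁻¹, |∇^η_U A′| < α₁(L^jη)⁻² on Ω_j»*); Thm 3.11 p. 416 *«Δ_a is positive definite»* is stated for backgrounds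
of that class.  A plaquette small-field condition (small `|U(∂p) − 1|`) is NOT on p. 396 — that is the form of [Balaban1987RG1] (1.11)–(1.14)
p. 262 ∕ [Balaban1985Variational], where the small gauge of (3.35) is produced from it.  Nothing of these statements is asserted here.

WHY THIS FILE (cell context).  Every small-field theorem of the pub-balaban NE9 chain (the owner's `B9Thm311SmallFieldClosed.laplaceAofBackground_pos_of_small_field`,
`B9Eq3126H1BoundCLM`, `Support/NE9CurChartUniformBall`, the leaves' `…Uniform` twins and `Support/NE9CurChartOneInstance*`) displays the background
through FIVE structural binders inherited from `B9Eq315QTorus` — `hU1` (unit-bounded periodic extension), `hreg` (`α`-regular block loops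
`‖W_{c,x}(Ũ) − 1‖ ≤ α`), `hα : α ≤ 1∕128`, `hα1 : α ≤ 1∕64`, `hαL : 50(d+1)αL^d ≤ ½` — plus the smallness `‖U(b) − 1‖ ≤ ε ≤ ε₃`.  At a small field the
five are CONSEQUENCES of the last: a loop of `≤ 2(d+1)L` unit-bounded bonds `ε`-close to `1` is `2(d+1)Lε`-close to `1` (ne9-leaf-04's
`B9Eq315QLipschitz.norm_Wcx_sub_one_le`, [Balaban1985Averaging] (42) p. 23), and the three scalar conditions hold once `ε ≤ 1∕(256(d+1)²L^{d+1})`.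
This file packages that reading so that the species face can be stated with ONE smallness number (the instancer's datum for Bałaban's `U_k` in a
small gauge, [Balaban1987RG1] (1.11)–(1.14) p. 262 ∕ [Balaban1985BackgroundPropagators] (3.35)–(3.37)).

WHAT IS PROVED (sorry-free; [folklore] bookkeeping; 0 def, no `Prop` placeholder; no inequality of the paper asserted).
* `perCfg_mem_U1`, `norm_perCfg_sub_one_le` — the periodic extension inherits `U(b) ∈ U1` and `‖U(b) − 1‖ ≤ ε` (reindexing).
* **`hreg_of_small_bonds`** — `‖W_{c,x}(Ũ) − 1‖ ≤ 2(d+1)L·ε` for every block corner, direction and in-block offset.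
* `epsReg_pos` (`ε_reg(d, L) := 1∕(256(d+1)²L^{d+1}) > 0`, written inline; private `mul_eps_le_one`), and for `0 ≤ ε ≤ ε_reg(d, L)`, `1 ≤ L`: **`alpha_le_128`** (`2(d+1)Lε ≤ 1∕128`),
  **`alpha_le_64`**, **`alphaL_le_half`** (`50(d+1)·(2(d+1)Lε)·L^d ≤ ½`).
* **`laplaceAofBackground_pos_of_small_bonds`** — [B9] Thm 3.11 for the chain's assembled `Δ_a(U)` (`B9Eq315QTorus.laplaceAofBackground` AT THE
  PRODUCED structural proofs `alpha_le_64 ∕ perCfg_mem_U1 ∕ hreg_of_small_bonds`): `∃ ε₃ > 0, ε₃ ≤ ε_reg(d, L) ∧ ∀ U` with `U(b) ∈ U1`,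
  `‖U(b) − 1‖ ≤ ε ≤ ε₃` and `hRS`, `0 < re⟨x, Δ_a(U)x⟩` for `x ≠ 0`; **`laplaceAofBackground_pos_of_small_bonds_unitary`** — the same with `hRS`
  discharged by `hRS_of_unitary` (unitary bond variables, tracial `τ`, `⟨φ⁻¹X, φ⁻¹Y⟩ = τ(X*Y)`).  By proof irrelevance the operator is the SAME term
  as E162's at any other admissible structural proofs.
MODEL / HONEST SCOPE.  The one-level periodic model of `B9Eq315QTorus` (fine torus `T_{L·m}`, coarse torus `T_m`, fibre `W` read in `𝔸` along `φ`);
the threshold `ε_reg` and `ε₃` are finite-lattice numbers (depend on `d, L, m, η, c₀, c₁, a, M_φ, M_φ′, C_τ`) — NOT print's uniform `α₀` of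
(3.35)–(3.36) (a gauge `u` on each cube with `U^u = e^{iηA}`, `A`, `∇^ηA`, `∂^{η*}∂^ηA` small, uniformly in the step `j`), NOT the passage from small
plaquette variables to such a gauge ([Balaban1985Variational] ∕ [Balaban1987RG1] (1.11)–(1.14)): the hypothesis here is bond-wise smallness in the
GIVEN gauge.
NOT summit progress (cell pub-balaban: NE9 NOT PRINTED / NOT PROVED; spine PROVED 0/9; rung (B)+1 finite T⁴ — NOT infinite volume, NOT mass gap,
NOT Clay).  Filed by the pub-balaban NE9 BINDER-row owner lineage `b2b-balaban-t4-ne9-p1` (gen 82); NEW file importing `B9Thm311SmallFieldClosed`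
only; nothing modified.  Net new unproved facts: 0.
-/

noncomputable section

open scoped InnerProductSpace BigOperators

namespace Literature.MathematicalPhysics.QuantumFieldTheory.Balaban1983to89.B9Eq335SmallBondsData

open B4Sect5Torus (TSite)
open B9SectCLatticeCarrier (Bond)
open B7Prop1Explicit (U1 Wcx boxVec)
open B9Eq319QprimeTorus (fineP)
open B11Eq103H1Complex (BondL2K)
open B9Eq310HessianOperator (adTransportW)
open B9Eq315QTorus (perCfg perSite cornerSite laplaceAofBackground)
open B9Eq315QLipschitz (norm_Wcx_sub_one_le)
open B9Thm311SmallFieldClosed (laplaceAofBackground_pos_of_small_field hRS_of_unitary)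

/-! ## §1 The periodic extension of a unit-bounded small-bond field -/

section Extension

variable {d : ℕ} (L : ℕ) (m : Fin d → ℕ) [∀ i, NeZero (fineP L m i)] {𝔸 : Type*} [NormedRing 𝔸] [NormOneClass 𝔸]
  {U : Bond d (fineP L m) → 𝔸ˣ}

omit [NormOneClass 𝔸] in
/-- The periodic extension `Ũ(x, κ) = U(x mod L·m, κ)` of a unit-bounded torus field is unit-bounded: E162's `hU1` from `U(b) ∈ U1`.
[cite: Balaban1985Averaging, (1) p.17; Balaban1985BackgroundPropagators, (3.1) p.390] -/
theorem perCfg_mem_U1 [NormOneClass 𝔸] (hU : ∀ b, U b ∈ U1 𝔸) (x : B7Prop1Explicit.Site d) (κ : Fin d) :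
    perCfg (fineP L m) U x κ ∈ U1 𝔸 :=
  hU _

omit [NormOneClass 𝔸] in
/-- The periodic extension of an `ε`-small field is `ε`-small. [cite: Balaban1985BackgroundPropagators, (3.35)–(3.37) p.396] -/
theorem norm_perCfg_sub_one_le {ε : ℝ} (hUε : ∀ b, ‖(U b : 𝔸) - 1‖ ≤ ε) (x : B7Prop1Explicit.Site d) (κ : Fin d) :
    ‖((perCfg (fineP L m) U x κ : 𝔸ˣ) : 𝔸) - 1‖ ≤ ε :=
  hUε _

/-- **THE BLOCK LOOPS OF A SMALL FIELD ARE `2(d+1)L·ε`-CLOSE TO `1`** — E162's `hreg` READ OFF the bond smallness: the staircase-contour holonomy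
`W_{c,x}(Ũ)` at a block corner `L·y`, direction `κ`, offset `r ∈ [0, L)^d` is a product of `≤ 2(d+1)L` unit-bounded bond variables each `ε`-close to `1`
(ne9-leaf-04's `B9Eq315QLipschitz.norm_Wcx_sub_one_le`). [cite: Balaban1985Averaging, (42) p.23, (14) p.19; Balaban1985BackgroundPropagators, (3.35) p.396] -/
theorem hreg_of_small_bonds (hU : ∀ b, U b ∈ U1 𝔸) {ε : ℝ} (hε : 0 ≤ ε) (hUε : ∀ b, ‖(U b : 𝔸) - 1‖ ≤ ε)
    (y : TSite d m) (κ : Fin d) (r : Fin d → Fin L) :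
    ‖((Wcx L (perCfg (fineP L m) U) (cornerSite L y) κ (boxVec L r) : 𝔸ˣ) : 𝔸) - 1‖ ≤ 2 * (d + 1) * L * ε :=
  norm_Wcx_sub_one_le (perCfg_mem_U1 L m hU) (norm_perCfg_sub_one_le L m hUε) L _ κ r hε

end Extension

/-! ## §2 The closed-form threshold `ε_reg(d, L)` and the three scalar conditions of E162 -/

section Threshold

/-- **`ε_reg(d, L) = 1∕(256·(d+1)²·L^{d+1}) > 0`** for `L ≥ 1` — the bond smallness below which `α := 2(d+1)L·ε` satisfies E162's three
displayed scalar conditions `α ≤ 1∕128`, `α ≤ 1∕64`, `50(d+1)·α·L^d ≤ ½` (the regime «α sufficiently small» of [4] Prop. 3 (121)–(126) in the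
cell's explicit reading; written INLINE everywhere — a finite-lattice number, not a constant of the paper).
[cite: Balaban1985Averaging, Prop. 3 (121)–(126) p.36; Balaban1985BackgroundPropagators, (3.35) p.396] -/
theorem epsReg_pos {d L : ℕ} (hL : 1 ≤ L) : (0 : ℝ) < 1 / (256 * ((d : ℝ) + 1) ^ 2 * (L : ℝ) ^ (d + 1)) := by
  have hLpos : (0 : ℝ) < L := by exact_mod_cast hL
  positivity

variable {d L : ℕ} (hL : 1 ≤ L) {ε : ℝ} (hε : 0 ≤ ε) (hεr : ε ≤ 1 / (256 * ((d : ℝ) + 1) ^ 2 * (L : ℝ) ^ (d + 1)))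

include hL hεr in
/-- The key product bound: `256(d+1)²L^{d+1}·ε ≤ 1` for `ε ≤ ε_reg(d, L)`. [folklore] -/
private theorem mul_eps_le_one : 256 * ((d : ℝ) + 1) ^ 2 * (L : ℝ) ^ (d + 1) * ε ≤ 1 := by
  have hLpos : (0 : ℝ) < L := by exact_mod_cast hL
  have hK : 0 < 256 * ((d : ℝ) + 1) ^ 2 * (L : ℝ) ^ (d + 1) := by positivity
  have h := mul_le_mul_of_nonneg_left hεr hK.le
  rwa [mul_one_div_cancel hK.ne'] at h

include hL hε hεr in
/-- **`α := 2(d+1)L·ε ≤ 1∕128`** for `ε ≤ ε_reg(d, L)` (E162's `hα`, the input of `B11Eq44COperatorTorus.quadAnalytic_Cc` and of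
`B9Eq315QTorusOnto.QtorusW_surjective`'s regime) — the cell's explicit reading of «α sufficiently small» in [4] Prop. 3.
[cite: Balaban1985Averaging, Prop. 3 (121)–(126) p.36; Balaban1985BackgroundPropagators, (3.35) p.396] -/
theorem alpha_le_128 : 2 * ((d : ℝ) + 1) * L * ε ≤ 1 / 128 := by
  have hLpos : (0 : ℝ) < L := by exact_mod_cast hL
  have hL1 : (1 : ℝ) ≤ L := by exact_mod_cast hL
  have hmain := mul_eps_le_one hL hεr
  -- `(d+1)·L^d ≥ 1`, so `256(d+1)Lε ≤ 256(d+1)²L^{d+1}ε ≤ 1`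
  have hd1 : (1 : ℝ) ≤ (d : ℝ) + 1 := by
    have : (0 : ℝ) ≤ d := Nat.cast_nonneg d
    linarith
  have hLd : (1 : ℝ) ≤ (L : ℝ) ^ d := one_le_pow₀ hL1
  have hx : 0 ≤ 2 * ((d : ℝ) + 1) * L * ε := by positivity
  have h1 : 2 * ((d : ℝ) + 1) * L * ε ≤ 2 * ((d : ℝ) + 1) * L * ε * (((d : ℝ) + 1) * (L : ℝ) ^ d) :=
    le_mul_of_one_le_right hx (one_le_mul_of_one_le_of_one_le hd1 hLd)
  have h2 : 2 * ((d : ℝ) + 1) * L * ε * (((d : ℝ) + 1) * (L : ℝ) ^ d) = (256 * ((d : ℝ) + 1) ^ 2 * (L : ℝ) ^ (d + 1) * ε) / 128 := by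
    rw [pow_succ]; ring
  rw [h2] at h1
  exact h1.trans (by linarith)

include hL hε hεr in
/-- **`α := 2(d+1)L·ε ≤ 1∕64`** for `ε ≤ ε_reg(d, L)` (E162's `hα1`, the regime of `B7Prop3GeneralLinear.linQAt`).
[cite: Balaban1985Averaging, Prop. 3 (121)–(126) p.36; Balaban1985BackgroundPropagators, (3.35) p.396] -/
theorem alpha_le_64 : 2 * ((d : ℝ) + 1) * L * ε ≤ 1 / 64 :=
  (alpha_le_128 hL hε hεr).trans (by norm_num)

include hL hεr in
/-- **`50(d+1)·α·L^d ≤ ½`** for `α := 2(d+1)L·ε`, `ε ≤ ε_reg(d, L)` (E162's `hαL`, the regime of `B9Eq315QTorusOnto.QtorusW_surjective`: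
`100(d+1)²L^{d+1}ε ≤ 100∕256 < ½`). [cite: Balaban1985Averaging, Prop. 3 (124)–(126) p.36; Balaban1985BackgroundPropagators, (3.15) p.393] -/
theorem alphaL_le_half : 50 * ((d : ℝ) + 1) * (2 * ((d : ℝ) + 1) * L * ε) * (L : ℝ) ^ d ≤ 1 / 2 := by
  have hmain := mul_eps_le_one hL hεr
  have h2 : 50 * ((d : ℝ) + 1) * (2 * ((d : ℝ) + 1) * L * ε) * (L : ℝ) ^ d =
      (256 * ((d : ℝ) + 1) ^ 2 * (L : ℝ) ^ (d + 1) * ε) * (100 / 256) := by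
    rw [pow_succ]; ring
  rw [h2]
  nlinarith

end Threshold

/-! ## §3 [B9] Thm 3.11 for the chain's `Δ_a(U)` with the background binders {`U1`, small bonds, `hRS`} only -/

section Thm311

variable {d : ℕ} (L : ℕ) [NeZero L] (m : Fin d → ℕ) [∀ i, NeZero (fineP L m i)] (hL : 1 ≤ L)
  {𝔸 : Type*} [NormedRing 𝔸] [NormedAlgebra ℂ 𝔸] [CompleteSpace 𝔸] [NormOneClass 𝔸] [StarRing 𝔸] [NormedStarGroup 𝔸] [StarModule ℂ 𝔸]
  {W : Type*} [NormedAddCommGroup W] [InnerProductSpace ℂ W] [FiniteDimensional ℂ W] (φ : W ≃ₗ[ℂ] 𝔸) {c₀ c₁ : ℝ} [Fact (0 < c₀)] [Fact (0 < c₁)]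

/-- **[B9] THM 3.11 FOR THE CHAIN'S ASSEMBLED `Δ_a(U)` AT EVERY UNIT-BOUNDED SMALL-BOND BACKGROUND OF A FIXED LATTICE** — the owner's
`B9Thm311SmallFieldClosed.laplaceAofBackground_pos_of_small_field` with E162's five structural binders PRODUCED from the bond smallness (§1–§2):
there is `ε₃ > 0` with `ε₃ ≤ ε_reg(d, L)` such that for EVERY `U` with `U(b) ∈ U1`, `‖U(b) − 1‖ ≤ ε ≤ ε₃` (and `ε ≤ ε_reg(d, L)`, implied) and
mutually adjoint transporters (`hRS`), `0 < re⟨x, Δ_a(U)x⟩` for `x ≠ 0`, `Δ_a(U)` = `laplaceAofBackground` at the structural proofs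
`alpha_le_64 ∕ perCfg_mem_U1 ∕ hreg_of_small_bonds` (`α := 2(d+1)Lε`).  Displayed: `hRS`, the trace∕fibre letters.  NOT print's uniform statement;
NOT the passage from small plaquette variables to print's small gauge (3.35)–(3.36). [cite: Balaban1985BackgroundPropagators, Thm 3.11 p.416, (3.35)–(3.37) p.396] -/
theorem laplaceAofBackground_pos_of_small_bonds {η : ℝ} (hη : η ≠ 0) {a : ℝ} (ha : 0 < a) {Mφ Mφ' : ℝ} (hMφ : 0 ≤ Mφ) (hMφ' : 0 ≤ Mφ')
    (hφ : ∀ w, ‖φ w‖ ≤ Mφ * ‖w‖) (hφ' : ∀ X, ‖φ.symm X‖ ≤ Mφ' * ‖X‖) (τ : 𝔸 →ₗ[ℂ] ℂ) {Cτ : ℝ} (hτ : ∀ X, ‖τ X‖ ≤ Cτ * ‖X‖) (hCτ : 0 ≤ Cτ) :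
    ∃ ε₃ : ℝ, 0 < ε₃ ∧ ε₃ ≤ 1 / (256 * ((d : ℝ) + 1) ^ 2 * (L : ℝ) ^ (d + 1)) ∧ ∀ (U : Bond d (fineP L m) → 𝔸ˣ) (hU : ∀ b, U b ∈ U1 𝔸) {ε : ℝ} (hε : 0 ≤ ε)
      (hεr : ε ≤ 1 / (256 * ((d : ℝ) + 1) ^ 2 * (L : ℝ) ^ (d + 1))), ε ≤ ε₃ → ∀ (hUε : ∀ b, ‖(U b : 𝔸) - 1‖ ≤ ε),
      (∀ (b : Bond d (fineP L m)) (v u : W), ⟪adTransportW φ U b v, u⟫_ℂ = ⟪v, adTransportW φ (fun b => (U b)⁻¹) b u⟫_ℂ) →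
      ∀ x : BondL2K ℂ d (fineP L m) c₀ W, x ≠ 0 →
        0 < RCLike.re ⟪x, laplaceAofBackground L m hL φ U (alpha_le_64 hL hε hεr) (perCfg_mem_U1 L m hU)
          (hreg_of_small_bonds L m hU hε hUε) τ η (c₀ := c₀) (c₁ := c₁) a x⟫_ℂ := by
  obtain ⟨ε₃, hε₃, H⟩ := laplaceAofBackground_pos_of_small_field L m hL φ (c₀ := c₀) (c₁ := c₁) hη ha hMφ hMφ' hφ hφ' τ hτ hCτ
  refine ⟨min ε₃ (1 / (256 * ((d : ℝ) + 1) ^ 2 * (L : ℝ) ^ (d + 1))), lt_min hε₃ (epsReg_pos hL), min_le_right _ _, ?_⟩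
  intro U hU ε hε hεr hε₃' hUε hRS x hx
  exact H U (alpha_le_64 hL hε hεr) (perCfg_mem_U1 L m hU) (hreg_of_small_bonds L m hU hε hUε) hε (hε₃'.trans (min_le_left _ _)) hUε hRS x hx

/-- **THE SAME WITH `hRS` DISCHARGED BY THE MODEL LETTERS** (`B9Thm311SmallFieldClosed.hRS_of_unitary`): for unitary bond variables
(`U(b)* = U(b)⁻¹`), a tracial `τ` and the norming `⟨φ⁻¹X, φ⁻¹Y⟩ = τ(X*Y)`, [B9] Thm 3.11 holds for the chain's assembled `Δ_a(U)` at EVERY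
unit-bounded small-bond background of a fixed lattice — background binders {`U(b) ∈ U1`, `U(b)` unitary, `‖U(b) − 1‖ ≤ ε ≤ ε₃`} and nothing else.
[cite: Balaban1985BackgroundPropagators, Thm 3.11 p.416, (3.5) p.391, (3.35) p.396; Balaban1985Variational, (18) p.277] -/
theorem laplaceAofBackground_pos_of_small_bonds_unitary {η : ℝ} (hη : η ≠ 0) {a : ℝ} (ha : 0 < a) {Mφ Mφ' : ℝ} (hMφ : 0 ≤ Mφ)
    (hMφ' : 0 ≤ Mφ') (hφ : ∀ w, ‖φ w‖ ≤ Mφ * ‖w‖) (hφ' : ∀ X, ‖φ.symm X‖ ≤ Mφ' * ‖X‖) (τ : 𝔸 →ₗ[ℂ] ℂ) {Cτ : ℝ}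
    (hτ : ∀ X, ‖τ X‖ ≤ Cτ * ‖X‖) (hCτ : 0 ≤ Cτ) (hτφ : ∀ X Y : 𝔸, ⟪φ.symm X, φ.symm Y⟫_ℂ = τ (star X * Y))
    (htr : ∀ X Y : 𝔸, τ (X * Y) = τ (Y * X)) :
    ∃ ε₃ : ℝ, 0 < ε₃ ∧ ε₃ ≤ 1 / (256 * ((d : ℝ) + 1) ^ 2 * (L : ℝ) ^ (d + 1)) ∧ ∀ (U : Bond d (fineP L m) → 𝔸ˣ) (hU : ∀ b, U b ∈ U1 𝔸) {ε : ℝ} (hε : 0 ≤ ε)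
      (hεr : ε ≤ 1 / (256 * ((d : ℝ) + 1) ^ 2 * (L : ℝ) ^ (d + 1))), ε ≤ ε₃ → ∀ (hUε : ∀ b, ‖(U b : 𝔸) - 1‖ ≤ ε), (∀ b, star (U b : 𝔸) = (((U b)⁻¹ : 𝔸ˣ) : 𝔸)) →
      ∀ x : BondL2K ℂ d (fineP L m) c₀ W, x ≠ 0 →
        0 < RCLike.re ⟪x, laplaceAofBackground L m hL φ U (alpha_le_64 hL hε hεr) (perCfg_mem_U1 L m hU)
          (hreg_of_small_bonds L m hU hε hUε) τ η (c₀ := c₀) (c₁ := c₁) a x⟫_ℂ := by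
  obtain ⟨ε₃, hε₃, hle, H⟩ := laplaceAofBackground_pos_of_small_bonds L m hL φ (c₀ := c₀) (c₁ := c₁) hη ha hMφ hMφ' hφ hφ' τ hτ hCτ
  exact ⟨ε₃, hε₃, hle, fun U hU ε hε hεr hε₃' hUε hUstar x hx =>
    H U hU hε hεr hε₃' hUε (hRS_of_unitary φ τ hτφ htr U hUstar) x hx⟩

end Thm311

end Literature.MathematicalPhysics.QuantumFieldTheory.Balaban1983to89.B9Eq335SmallBondsData

end
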